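import Summits.ResolutionOfSingularities.ResolutionOfSingularities.Theorems.WeightedInvariantIota3SigmaExtLevelDescent
import Summits.ResolutionOfSingularities.ResolutionOfSingularities.Theorems.WeightedInvariantIota3TwoFlagExtended
import HarnessLib

/-!
# (LVL-desc)₃ ⟸ (IDL-desc)₃: descent of σ-maximising triples is the descent of TWO IDEALS (door `HypersurfaceCentreConstruction`,
# stmt-ResolutionOfSingularities-19897; P3 rung `stub_keyRungGrHomLE_three`, gap (σ-ext)₃ / (LVL-desc)₃)

Topic: `Summits/ResolutionOfSingularities/ResolutionOfSingularities/Theorems`. Helper for the door item `HypersurfaceCentreConstruction`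
(stmt-ResolutionOfSingularities-19897, route `WeightedInvariant`), line `local-engine` (skeleton v3.12 `7a4b52ef`), def-free.  Sequel of
`keyRungGrHomLE_three_of_levelDescent3` (…Iota3SigmaExtLevelDescent, p819685), whose σ-input (LVL-desc)₃ asks for a two-flag DOWNSTAIRS
reaching a σ-maximising triple `(q; r₁, r₂)`, `q < r₂`, reached UPSTAIRS along a 𝔪-preserving local formally smooth e.f.t. `φ : A → A'` of
regular local rings of dimension three.  By the tree's «LEMMA R» (`JFlatEssSmooth.flagReaches_of_extended`, …Iota3TwoFlagExtended: a two-flag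
filtration whose two defining levels `F'(r₁)`, `F'(r₂)` are EXTENDED ideals is the filtration of a two-flag of `A`, by the upgrade lemma
`Iota3.flagContactFiltration_eq_of_oneSided` and faithful flatness) this is implied by the IDEAL-descent statement

  **(IDL-desc)₃** «for such `φ`, `g ∈ 𝔪_A ∖ 0`, an admissible `(q; r₁, r₂)` with `q < r₂` at the maximal ratio of `g`, and a two-flag
  `(g₁', g₂')` of `A'` carrying `φ g` to `(q; r₁, r₂)`: the levels `F'(r₁)` and `F'(r₂)` are extended from `A`»

(`levelDescent_three_of_idealDescent`), giving the gap list **`keyRungGrHomLE_three_of_idealDescent3`** with FIVE hypotheses: (desc-τ),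
(IDL-desc)₃, GAP 2, hgame, the residue of the dominance word at the power positions.  Where the dominance word holds (DOM-RATIO-ONE.md:
`r₁ = r₂`, `r₂ = q`, and OUTRIGHT off the power positions `in(g) = c·ℓ^ν`) the two ideals do not depend on the maximising flag, so
(IDL-desc)₃ is a descent question for two CANONICAL ideals of `A'` (Galois route: …Iota3SigmaGaloisDescent; torus route `T → T(X)`:
…Iota3SigmaGenericFibre), not for flags.  Descent chain of this hand: (σ-ext) ⟸ (σ-ext)₃ (p819524) ⟸ (LVL-desc)₃ (p819685) ⟸ (IDL-desc)₃.

[OURS · L1 W4.3 · audit glue]  Replaces the role of NO printed item; NOT a statement of the manuscript [claim: Hironaka2017, status: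
under-review]; candidates stay candidates; AI work, weaker than expert review.  No definition; no axiom.

## References

* H. Hironaka, *Characteristic polyhedra of singularities*, J. Math. Kyoto Univ. 7 (1967), §3. [Hironaka1967]
* H. Matsumura, *Commutative Ring Theory* (1987), Thm. 2.3, Thm. 7.5. [Matsumura1987]
-/

noncomputable section

set_option linter.dupNamespace false -- mandated namespace `Summit.<Summit>.<Problem>` of this single-conjunct summit

open IsLocalRing Literature.AlgebraicGeometry.Resolution
open Summit.ResolutionOfSingularities.ResolutionOfSingularities.Theorems

namespace Summit.ResolutionOfSingularities.ResolutionOfSingularities.Cruxes.HypersurfaceCentreConstruction.LocalEngine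

namespace Iota3

/-- **(LVL-desc)₃ ⟸ (IDL-desc)₃**: descent of σ-maximising triples (`q < r₂`) follows from the descent of the two IDEALS `F'(r₁)`, `F'(r₂)`
of the upstairs reaching flag («LEMMA R» `JFlatEssSmooth.flagReaches_of_extended`). [cite: Hironaka1967, §3] [OURS · L1 W4.3 · audit glue] -/
theorem levelDescent_three_of_idealDescent
    (hidl : ∀ (A A' : Type) [CommRing A] [IsRegularLocalRing A] [CommRing A'] [IsRegularLocalRing A'] [Algebra A A']
      [IsLocalHom (algebraMap A A')] [Algebra.FormallySmooth A A'] [Algebra.EssFiniteType A A'] (g : A),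
      ringKrullDim A = (3 : ℕ) → ringKrullDim A' = (3 : ℕ) → (maximalIdeal A).map (algebraMap A A') = maximalIdeal A' →
      g ≠ 0 → g ∈ maximalIdeal A → ∀ q r₁ r₂ : ℕ, AdmissibleTriple q r₁ r₂ → q < r₂ →
      ratioScale (adicOrder g).toNat * r₁ = sigmaRatioNat g * r₂ →
      ∀ g₁' g₂' : A', IsTwoFlag g₁' g₂' →
      algebraMap A A' g ∈ flagContactFiltration g₁' g₂' q r₁ r₂ (r₁ * (adicOrder g).toNat) →
      ∃ J₁ J₂ : Ideal A, J₁.map (algebraMap A A') = flagContactFiltration g₁' g₂' q r₁ r₂ r₁ ∧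
        J₂.map (algebraMap A A') = flagContactFiltration g₁' g₂' q r₁ r₂ r₂) :
    ∀ (A A' : Type) [CommRing A] [IsRegularLocalRing A] [CommRing A'] [IsRegularLocalRing A'] [Algebra A A']
      [IsLocalHom (algebraMap A A')] [Algebra.FormallySmooth A A'] [Algebra.EssFiniteType A A'] (g : A),
      ringKrullDim A = (3 : ℕ) → ringKrullDim A' = (3 : ℕ) → (maximalIdeal A).map (algebraMap A A') = maximalIdeal A' →
      g ≠ 0 → g ∈ maximalIdeal A → ∀ q r₁ r₂ : ℕ, AdmissibleTriple q r₁ r₂ → q < r₂ →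
      ratioScale (adicOrder g).toNat * r₁ = sigmaRatioNat g * r₂ →
      FlagReaches (algebraMap A A' g) (adicOrder g).toNat q r₁ r₂ → FlagReaches g (adicOrder g).toNat q r₁ r₂ := by
  intro A A' _ _ _ _ _ _ _ _ g ha hb h𝔪 hg0 hg q r₁ r₂ hadm hq hratio hreach
  haveI : Module.Flat A A' := IotaOrderEssSmooth.flat_of_formallySmooth_of_essFiniteType A A'
  obtain ⟨g₁', g₂', hfl, hmem⟩ := hreach
  obtain ⟨J₁, J₂, hJ₁, hJ₂⟩ := hidl A A' g ha hb h𝔪 hg0 hg q r₁ r₂ hadm hq hratio g₁' g₂' hfl hmem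
  exact JFlatEssSmooth.flagReaches_of_extended h𝔪 hfl hadm hJ₁ hJ₂ hmem

/-- **(σ-ext)₃ ⟸ (IDL-desc)₃** (through (LVL-desc)₃, `sigmaExt_three_of_levelDescent`). [OURS · L1 W4.3 · audit glue] -/
theorem sigmaExt_three_of_idealDescent
    (hidl : ∀ (A A' : Type) [CommRing A] [IsRegularLocalRing A] [CommRing A'] [IsRegularLocalRing A'] [Algebra A A']
      [IsLocalHom (algebraMap A A')] [Algebra.FormallySmooth A A'] [Algebra.EssFiniteType A A'] (g : A),
      ringKrullDim A = (3 : ℕ) → ringKrullDim A' = (3 : ℕ) → (maximalIdeal A).map (algebraMap A A') = maximalIdeal A' →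
      g ≠ 0 → g ∈ maximalIdeal A → ∀ q r₁ r₂ : ℕ, AdmissibleTriple q r₁ r₂ → q < r₂ →
      ratioScale (adicOrder g).toNat * r₁ = sigmaRatioNat g * r₂ →
      ∀ g₁' g₂' : A', IsTwoFlag g₁' g₂' →
      algebraMap A A' g ∈ flagContactFiltration g₁' g₂' q r₁ r₂ (r₁ * (adicOrder g).toNat) →
      ∃ J₁ J₂ : Ideal A, J₁.map (algebraMap A A') = flagContactFiltration g₁' g₂' q r₁ r₂ r₁ ∧
        J₂.map (algebraMap A A') = flagContactFiltration g₁' g₂' q r₁ r₂ r₂) :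
    ∀ (A A' : Type) [CommRing A] [IsRegularLocalRing A] [CommRing A'] [IsRegularLocalRing A'] [Algebra A A']
      [IsLocalHom (algebraMap A A')] [Algebra.FormallySmooth A A'] [Algebra.EssFiniteType A A'] (g : A),
      ringKrullDim A = (3 : ℕ) → ringKrullDim A' = (3 : ℕ) → (maximalIdeal A).map (algebraMap A A') = maximalIdeal A' →
      iotaSigma A' (algebraMap A A' g) = iotaSigma A g :=
  sigmaExt_three_of_levelDescent (levelDescent_three_of_idealDescent hidl)

end Iota3

open Iota3 in
/-- **P3 RUNG FOR THE NAMED PAIR MODULO FIVE HYPOTHESES, σ-INPUT = DESCENT OF TWO IDEALS**: (desc-τ), **(IDL-desc)₃** «for `φ : A → A'`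
(regular local of dimension three, 𝔪-preserving, local formally smooth e.f.t.), `g ∈ 𝔪_A ∖ 0`, an admissible `(q; r₁, r₂)` with `q < r₂` at the
maximal ratio of `g` and a two-flag `(g₁', g₂')` of `A'` carrying `φ g` to it, the levels `F'(r₁)`, `F'(r₂)` are extended from `A`», GAP 2,
hgame, the residue of the dominance word at the power positions. [OURS · L1 W4.3 · audit glue] -/
theorem keyRungGrHomLE_three_of_idealDescent3 (p : ℕ)
    (hD : ∀ (T T' : Type) [CommRing T] [IsRegularLocalRing T] [CommRing T'] [IsRegularLocalRing T'] [Algebra T T']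
      [IsLocalHom (algebraMap T T')] [Algebra.FormallySmooth T T'] [Algebra.EssFiniteType T T'] (g : T),
      ringKrullDim T' ≤ 3 → IsTiePosition T' (algebraMap T T' g) → IsTiePosition T g)
    (hidl : ∀ (A A' : Type) [CommRing A] [IsRegularLocalRing A] [CommRing A'] [IsRegularLocalRing A'] [Algebra A A']
      [IsLocalHom (algebraMap A A')] [Algebra.FormallySmooth A A'] [Algebra.EssFiniteType A A'] (g : A),
      ringKrullDim A = (3 : ℕ) → ringKrullDim A' = (3 : ℕ) → (maximalIdeal A).map (algebraMap A A') = maximalIdeal A' →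
      g ≠ 0 → g ∈ maximalIdeal A → ∀ q r₁ r₂ : ℕ, AdmissibleTriple q r₁ r₂ → q < r₂ →
      ratioScale (adicOrder g).toNat * r₁ = sigmaRatioNat g * r₂ →
      ∀ g₁' g₂' : A', IsTwoFlag g₁' g₂' →
      algebraMap A A' g ∈ flagContactFiltration g₁' g₂' q r₁ r₂ (r₁ * (adicOrder g).toNat) →
      ∃ J₁ J₂ : Ideal A, J₁.map (algebraMap A A') = flagContactFiltration g₁' g₂' q r₁ r₂ r₁ ∧
        J₂.map (algebraMap A A') = flagContactFiltration g₁' g₂' q r₁ r₂ r₂)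
    (hgap2 : ∀ (T T' : Type) [CommRing T] [IsRegularLocalRing T] [CommRing T'] [IsRegularLocalRing T'] [Algebra T T']
      [IsLocalHom (algebraMap T T')] [Algebra.FormallySmooth T T'] [Algebra.EssFiniteType T T'] (g : T),
      ringKrullDim T' ≤ 3 → (maximalIdeal T).map (algebraMap T T') = maximalIdeal T' → ringKrullDim T = (3 : ℕ) →
      iotaEps T g = 0 → ∀ m : ℕ, jSigmaPt T' (algebraMap T T' g) m = (jSigmaPt T g m).map (algebraMap T T'))
    (hgame : CanonicalGameClauseHomLE 3 p iotaFlatT jFlatT)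
    (hres : ∀ (k₀ : Type) [Field k₀] [CharP k₀ p] [PerfectField k₀]
      (S : Type) [CommRing S] [Algebra k₀ S] [Algebra.EssFiniteType k₀ S] [IsRegularLocalRing S] (f : S),
      ringKrullDim S = (3 : ℕ) → f ≠ 0 → f ∈ (maximalIdeal S) ^ 2 →
      ContactCylinder.topStratumPrime iotaOrdEpsTau S f = maximalIdeal S → iotaEps S f ≠ 1 →
      (∃ ℓ ∈ maximalIdeal S, f ∈ Ideal.span {ℓ ^ (adicOrder f).toNat} ⊔ maximalIdeal S ^ ((adicOrder f).toNat + 1)) →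
      ∀ (a b : ℕ), 0 < b →
      (∀ q' r₁' r₂' : ℕ, AdmissibleTriple q' r₁' r₂' → FlagReaches f (adicOrder f).toNat q' r₁' r₂' → r₁' * b ≤ a * r₂') →
      ∀ (g₁ g₂ g₁' g₂' : S) (q r₁ r₂ : ℕ), AdmissibleTriple q r₁ r₂ → r₁ * b = a * r₂ → q < r₂ → r₂ < r₁ →
        IsTwoFlag g₁ g₂ → IsTwoFlag g₁' g₂' →
        f ∈ flagContactFiltration g₁ g₂ q r₁ r₂ (r₁ * (adicOrder f).toNat) →
        f ∈ flagContactFiltration g₁' g₂' q r₁ r₂ (r₁ * (adicOrder f).toNat) →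
        g₂' ∈ flagContactFiltration g₁ g₂ q r₁ r₂ r₂) :
    KeyRungGrHomLE 3 p :=
  keyRungGrHomLE_three_of_levelDescent3 p hD (levelDescent_three_of_idealDescent hidl) hgap2 hgame hres

end Summit.ResolutionOfSingularities.ResolutionOfSingularities.Cruxes.HypersurfaceCentreConstruction.LocalEngine

end
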